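import Literature.NumberTheory.Automorphic.ReciprocityGLn
import Literature.NumberTheory.Automorphic.LanglandsTetrahedral
import Literature.NumberTheory.Automorphic.ChebotarevArtinRepHolds
import Literature.NumberTheory.GaloisRepresentations.FrobeniusDensity
import Literature.NumberTheory.GaloisRepresentations.GaloisRepOfLadicLimit
import HarnessLib

/-!
# Crux `AdjointLiftingGL3` (stmt-Langlands-16779), line `birth`, stub S6 (`stub_galoisSeed`):
# Frobenius bookkeeping for the Galois seed

Two interface-independent lemmas of step (7) of the Galois-seed stub (trace identification of
`r_ι(Ad(π_g) ⊗ χ)` with `μ ε_p⁻¹ ⊗ ad⁰ ρ_g`):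

* `charpoly_eq_of_eventually_hasFrobCharpolyAt` / `trace_eq_of_eventually_hasFrobCharpolyAt` —
  **two continuous `r, r' : Γ_K → GL_n(ℚ̄_p)` with the same characteristic polynomial of Frobenius
  at all but finitely many places have the same characteristic polynomials (hence traces)
  EVERYWHERE**: the coefficients of `σ ↦ det(X − r(σ))` are continuous
  (`LadicLimit.continuous_coeff_charpoly`), `ℚ̄_p` is Hausdorff, and the
  arithmetic Frobenius elements at the places outside any finite set are dense in `Γ_K` (the tree's
  `absoluteGaloisGroup.frobenius_dense` with the PROVED Chebotarev existence form
  `chebotarev_artinRep_holds`).  Serre, *Abelian ℓ-adic representations*, I-2.3.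
* `arithFrobPolyOfSatake_three_adParams` — **the Harris–Lan–Taylor–Thorne polynomial of the
  twisted adjoint Satake parameter**: if `∏_{x ∈ α} (X − x) = X² − a q^{-1/2} X + e` (the unitary
  Satake parameter of a weight-two eigenform at `q`, `e = ε(q) ≠ 0`) then
  `arithFrobPolyOfSatake ι q 3 (c · Ad(α)) = (X − d)(X² − d (t²/e' − 2) X + d²)` with
  `d = ι⁻¹((q c)⁻¹)`, `t = ι⁻¹(a)`, `e' = ι⁻¹(e q)` — i.e. exactly the shape of the tree's
  `FramedRep.charpoly_adZeroTwoTwist` for a `2`-dimensional `ρ_g` with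
  `det(X − ρ_g(Frob_q)) = X² − t X + e'` twisted by a character with value `d` at `Frob_q`.
-/

set_option linter.dupNamespace false -- `Summit.Langlands.Langlands` is the mandated namespace

noncomputable section

namespace Summit.Langlands.Langlands.Cruxes.AdjointLiftingGL3.Birth

open scoped MatrixGroups NumberField Polynomial
open NumberField IsDedekindDomain Field Filter Polynomial
open Literature.NumberTheory.GaloisRepresentations Literature.NumberTheory.Automorphic

/-! ## Equality of characteristic polynomials from almost all Frobenius elements -/

section Density

/-- **Two continuous `p`-adic Galois representations with the same characteristic polynomial of
Frobenius at all but finitely many places have the same characteristic polynomials everywhere.**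
For `r, r' : Γ_K →ₜ* GL_n(ℚ̄_p)`: if for all but finitely many finite places `v` of the number
field `K` some polynomial is the characteristic polynomial of every arithmetic Frobenius above `v`
for both `r` and `r'` (`HasFrobCharpolyAt`), then `det(X − r(σ)) = det(X − r'(σ))` for every
`σ ∈ Γ_K` — the coefficients are continuous into the Hausdorff `ℚ̄_p` and agree on the dense set of
Frobenius elements outside the exceptional set (`absoluteGaloisGroup.frobenius_dense`, Chebotarev).
[cite: SerreAbelianLadic1968, Ch. I §2.3 (proof of the uniqueness in Thm.; §2.2 Cor. 2 (a))] -/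
theorem charpoly_eq_of_eventually_hasFrobCharpolyAt :
    ∀ {K : Type} [Field K] [NumberField K] {p : ℕ} [Fact p.Prime] {n : ℕ}
      (r r' : FramedGaloisRep K (PadicAlgCl p) n),
      (∀ᶠ v : HeightOneSpectrum (𝓞 K) in cofinite,
        ∃ P : Polynomial (PadicAlgCl p), r.HasFrobCharpolyAt v P ∧ r'.HasFrobCharpolyAt v P) →
      ∀ σ : absoluteGaloisGroup K, FramedRep.charpoly r σ = FramedRep.charpoly r' σ := by
  intro K _ _ p _ n r r' h σ
  set S : Set (HeightOneSpectrum (𝓞 K)) :=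
    {v | ¬ ∃ P : Polynomial (PadicAlgCl p), r.HasFrobCharpolyAt v P ∧ r'.HasFrobCharpolyAt v P}
    with hSdef
  have hS : S.Finite := by
    rw [hSdef]
    exact Filter.eventually_cofinite.mp h
  have hD := absoluteGaloisGroup.frobenius_dense chebotarev_artinRep_holds K S hS
  -- on the dense set of good Frobenius elements the two characteristic polynomials agree
  have hDeq : ∀ τ ∈ {σ : absoluteGaloisGroup K |
      ∃ v ∉ S, ∃ 𝔓 ∈ v.primesAbove, IsArithFrobAt (𝓞 K) σ 𝔓},
      FramedRep.charpoly r τ = FramedRep.charpoly r' τ := by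
    rintro τ ⟨v, hvS, 𝔓, h𝔓, hτ⟩
    have hv : ∃ P : Polynomial (PadicAlgCl p), r.HasFrobCharpolyAt v P ∧ r'.HasFrobCharpolyAt v P := by
      by_contra hcon
      exact hvS hcon
    obtain ⟨P, hP, hP'⟩ := hv
    exact (hP 𝔓 h𝔓 τ hτ).trans (hP' 𝔓 h𝔓 τ hτ).symm
  -- coefficientwise, by continuity
  refine Polynomial.ext fun k => ?_
  have hcont := (LadicLimit.continuous_coeff_charpoly r k)
  have hcont' := (LadicLimit.continuous_coeff_charpoly r' k)
  have hfun : (fun g => (FramedRep.charpoly r g).coeff k) = fun g => (FramedRep.charpoly r' g).coeff k :=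
    Continuous.ext_on hD hcont hcont' fun τ hτ => by
      simp only [hDeq τ hτ]
  exact congrFun hfun σ

/-- **Trace form**: under the hypothesis of `charpoly_eq_of_eventually_hasFrobCharpolyAt`,
`tr r(σ) = tr r'(σ)` for every `σ ∈ Γ_K` (the trace is minus the second coefficient of the
characteristic polynomial, Mathlib `Matrix.trace_eq_neg_charpoly_coeff`).
[cite: SerreAbelianLadic1968, Ch. I §2.3] -/
theorem trace_eq_of_eventually_hasFrobCharpolyAt :
    ∀ {K : Type} [Field K] [NumberField K] {p : ℕ} [Fact p.Prime] {n : ℕ}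
      (r r' : FramedGaloisRep K (PadicAlgCl p) n),
      (∀ᶠ v : HeightOneSpectrum (𝓞 K) in cofinite,
        ∃ P : Polynomial (PadicAlgCl p), r.HasFrobCharpolyAt v P ∧ r'.HasFrobCharpolyAt v P) →
      ∀ σ : absoluteGaloisGroup K,
        ((r σ : GL (Fin n) (PadicAlgCl p)) : Matrix (Fin n) (Fin n) (PadicAlgCl p)).trace =
          ((r' σ : GL (Fin n) (PadicAlgCl p)) : Matrix (Fin n) (Fin n) (PadicAlgCl p)).trace := by
  intro K _ _ p _ n r r' h σ
  have hc := charpoly_eq_of_eventually_hasFrobCharpolyAt r r' h σ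
  rcases Nat.eq_zero_or_pos n with rfl | hn
  · simp [Matrix.trace]
  · haveI : Nonempty (Fin n) := ⟨⟨0, hn⟩⟩
    rw [Matrix.trace_eq_neg_charpoly_coeff, Matrix.trace_eq_neg_charpoly_coeff]
    simp only [FramedRep.charpoly] at hc
    rw [hc]

/-- **Determinant form**: under the same hypothesis, `det r(σ) = det r'(σ)` for every `σ`
(Mathlib `Matrix.det_eq_sign_charpoly_coeff`). [cite: SerreAbelianLadic1968, Ch. I §2.3] -/
theorem det_eq_of_eventually_hasFrobCharpolyAt :
    ∀ {K : Type} [Field K] [NumberField K] {p : ℕ} [Fact p.Prime] {n : ℕ}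
      (r r' : FramedGaloisRep K (PadicAlgCl p) n),
      (∀ᶠ v : HeightOneSpectrum (𝓞 K) in cofinite,
        ∃ P : Polynomial (PadicAlgCl p), r.HasFrobCharpolyAt v P ∧ r'.HasFrobCharpolyAt v P) →
      ∀ σ : absoluteGaloisGroup K,
        ((r σ : GL (Fin n) (PadicAlgCl p)) : Matrix (Fin n) (Fin n) (PadicAlgCl p)).det =
          ((r' σ : GL (Fin n) (PadicAlgCl p)) : Matrix (Fin n) (Fin n) (PadicAlgCl p)).det := by
  intro K _ _ p _ n r r' h σ
  have hc := charpoly_eq_of_eventually_hasFrobCharpolyAt r r' h σ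
  simp only [FramedRep.charpoly] at hc
  rw [Matrix.det_eq_sign_charpoly_coeff, Matrix.det_eq_sign_charpoly_coeff, hc]

end Density

/-! ## The HLTT polynomial of the twisted adjoint Satake parameter -/

section AdParams

/-- A cubic identity over a field: for `x y Q ≠ 0`,
`(X − (Q·x/y)⁻¹)(X − (Q·y/x)⁻¹)(X − Q⁻¹) = (X − d)(X² − d (x/y + y/x) X + d²)` with `d = Q⁻¹`.
[folklore] -/
theorem cubic_adjoint_identity {F : Type*} [Field F] {x y Q : F} (hx : x ≠ 0) (hy : y ≠ 0)
    (hQ : Q ≠ 0) :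
    (X - C (Q * (x * y⁻¹))⁻¹) * ((X - C (Q * (y * x⁻¹))⁻¹) * (X - C Q⁻¹)) =
      (X - C Q⁻¹) * (X ^ 2 - C (Q⁻¹ * (x * y⁻¹ + y * x⁻¹)) * X + C (Q⁻¹ ^ 2)) := by
  have h1 : (Q * (x * y⁻¹))⁻¹ = Q⁻¹ * (y * x⁻¹) := by field_simp
  have h2 : (Q * (y * x⁻¹))⁻¹ = Q⁻¹ * (x * y⁻¹) := by field_simp
  rw [h1, h2]
  have h3 : (Q⁻¹ * (y * x⁻¹)) * (Q⁻¹ * (x * y⁻¹)) = Q⁻¹ ^ 2 := by field_simp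
  -- compare both sides as polynomials
  have : (X - C (Q⁻¹ * (y * x⁻¹))) * (X - C (Q⁻¹ * (x * y⁻¹))) =
      X ^ 2 - C (Q⁻¹ * (x * y⁻¹ + y * x⁻¹)) * X + C (Q⁻¹ ^ 2) := by
    rw [← h3]
    simp only [map_mul, map_add]
    ring
  rw [← this]
  ring

/-- **The Harris–Lan–Taylor–Thorne polynomial of `c · Ad(α)` for a weight-two Satake pair.**
Let `ι : ℚ̄_p ≃ ℂ`, `q > 0`, `e ≠ 0`, `c ≠ 0`, and let the multiset `α` satisfy
`∏_{x ∈ α} (X − x) = X² − a (√q)^{1-2} X + e` (the unitary Satake parameter of a weight-`2`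
eigenform with `T_q`-eigenvalue `a` and nebentypus value `e = ε(q)`, as produced by
`exists_cuspidalAutomorphicRepData_newform`).  Then the predicted characteristic polynomial of an
arithmetic Frobenius for the rank-`3` Satake parameter `c · Ad(α) = {c x/y, c y/x, c}`
(`adParams`, Gelbart–Jacquet) is
`arithFrobPolyOfSatake ι q 3 (c · Ad(α)) = (X − d)(X² − d (t² e'⁻¹ − 2) X + d²)`,
`d = ι⁻¹((q c)⁻¹)`, `t = ι⁻¹(a)`, `e' = ι⁻¹(e q)` — the characteristic polynomial
`charpoly_adZeroTwoTwist` of `d · Ad⁰(F)` for any `F ∈ GL₂(ℚ̄_p)` with `det(X − F) = X² − t X + e'`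
(`tr Ad⁰(F) = t²/e' − 1`).  This is the `n = 3` adjoint analogue of the tree's
`arithFrobPolyOfSatake_heckeRoots`. [cite: HarrisLanTaylorThorneRMS2016, Thm. A (normalisation
`rec(π_v |det|^{(1-n)/2})`)] [cite: GelbartJacquet1978, Thm. (9.3)] -/
theorem arithFrobPolyOfSatake_three_adParams :
    ∀ {p : ℕ} [Fact p.Prime] (ι : PadicAlgCl p ≃+* ℂ) (q : ℕ), 0 < q →
      ∀ (a e c : ℂ), e ≠ 0 → c ≠ 0 → ∀ α : Multiset ℂ,
        satakePolynomial α =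
          X ^ 2 - C (a * ((Real.sqrt q : ℝ) : ℂ) ^ (1 - (2 : ℤ))) * X + C e →
        arithFrobPolyOfSatake ι q 3 ((adParams α).map (c * ·)) =
          (X - C (ι.symm (((q : ℂ) * c)⁻¹))) *
            (X ^ 2 - C (ι.symm (((q : ℂ) * c)⁻¹) *
                ((ι.symm a) ^ 2 * (ι.symm (e * q))⁻¹ - 2)) * X +
              C ((ι.symm (((q : ℂ) * c)⁻¹)) ^ 2)) := by
  intro p _ ι q hq a e c he hc α hα
  set r : ℂ := ((Real.sqrt q : ℝ) : ℂ) with hr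
  have hr0 : r ≠ 0 := by
    rw [hr]; exact_mod_cast (Real.sqrt_pos.2 (Nat.cast_pos.2 hq)).ne'
  have hr2 : r ^ 2 = (q : ℂ) := by
    rw [hr, ← Complex.ofReal_pow, Real.sq_sqrt (Nat.cast_nonneg _), Complex.ofReal_natCast]
  have hq0 : (q : ℂ) ≠ 0 := by exact_mod_cast hq.ne'
  -- `α = {x, y}` with `x + y = a r⁻¹`, `x y = e`
  have hcard : Multiset.card α = 2 := by
    have h := natDegree_satakePolynomial α
    rw [hα] at h
    have h2 : (X ^ 2 - C (a * r ^ (1 - (2 : ℤ))) * X + C e : ℂ[X]).natDegree = 2 := by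
      compute_degree!
    omega
  obtain ⟨x, y, rfl⟩ := Multiset.card_eq_two.1 hcard
  have hroots := roots_satakePolynomial ({x, y} : Multiset ℂ)
  have hprod : x * y = e := by
    have h0 := congrArg (fun P : ℂ[X] => P.coeff 0) hα
    simp only [satakePolynomial, Multiset.insert_eq_cons, Multiset.map_cons, Multiset.map_singleton,
      Multiset.prod_cons, Multiset.prod_singleton, coeff_zero_eq_eval_zero, eval_mul, eval_sub,
      eval_X, eval_C, eval_add, eval_pow, zero_sub, neg_mul_neg, mul_zero, sub_zero,
      zero_pow two_ne_zero, zero_add] at h0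
    exact h0
  have hsum : x + y = a * r ^ (1 - (2 : ℤ)) := by
    have h1 := congrArg (fun P : ℂ[X] => P.coeff 1) hα
    simp only [satakePolynomial, Multiset.insert_eq_cons, Multiset.map_cons, Multiset.map_singleton,
      Multiset.prod_cons, Multiset.prod_singleton] at h1
    have e1 : ((X - C x) * (X - C y) : ℂ[X]).coeff 1 = -(x + y) := by
      have : ((X - C x) * (X - C y) : ℂ[X]) = X ^ 2 - C (x + y) * X + C (x * y) := by
        simp only [map_add, map_mul]; ring
      rw [this]
      simp [coeff_X_pow, coeff_C]
    have e2 : (X ^ 2 - C (a * r ^ (1 - (2 : ℤ))) * X + C e : ℂ[X]).coeff 1 = -(a * r ^ (1 - (2 : ℤ))) := by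
      simp [coeff_X_pow, coeff_C]
    rw [e1, e2, neg_inj] at h1
    exact h1
  have hx : x ≠ 0 := fun h => he (by rw [← hprod, h, zero_mul])
  have hy : y ≠ 0 := fun h => he (by rw [← hprod, h, mul_zero])
  -- `a² / (e q) - 2 = x/y + y/x`
  have hzpow : r ^ (1 - (2 : ℤ)) = r⁻¹ := by
    rw [show (1 - (2 : ℤ)) = -1 by norm_num, zpow_neg_one]
  rw [hzpow] at hsum
  have ha : a = (x + y) * r := by
    rw [hsum, mul_assoc, inv_mul_cancel₀ hr0, mul_one]
  have hkey : a ^ 2 * (e * q)⁻¹ - 2 = x * y⁻¹ + y * x⁻¹ := by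
    rw [ha, ← hprod, ← hr2]
    field_simp
    ring
  -- push everything through `ι.symm`
  have hι : ∀ z : ℂ, ι.symm z = (ι.symm : ℂ →+* PadicAlgCl p) z := fun _ => rfl
  have hkey' : (ι.symm a) ^ 2 * (ι.symm (e * q))⁻¹ - 2 = ι.symm (x * y⁻¹ + y * x⁻¹) := by
    rw [← hkey]
    simp only [map_sub, map_mul, map_pow, map_inv₀, map_ofNat]
  rw [hkey']
  -- the left-hand side, explicitly
  rw [adParams_pair hx hy]
  simp only [arithFrobPolyOfSatake, Multiset.insert_eq_cons, Multiset.map_cons,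
    Multiset.map_singleton, Multiset.prod_cons, Multiset.prod_singleton,
    show (3 - 1 : ℕ) = 2 from rfl, mul_one]
  rw [← hr, hr2]
  -- both sides are images under `C ∘ ι.symm` of the complex identity `cubic_adjoint_identity`
  set Q : ℂ := (q : ℂ) * c with hQdef
  have hQ : Q ≠ 0 := mul_ne_zero hq0 hc
  have hQx : (q : ℂ) * (c * (x * y⁻¹)) = Q * (x * y⁻¹) := by rw [hQdef, mul_assoc]
  have hQy : (q : ℂ) * (c * (y * x⁻¹)) = Q * (y * x⁻¹) := by rw [hQdef, mul_assoc]
  rw [hQx, hQy, ← map_mul ι.symm, ← map_pow ι.symm]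
  have hC := congrArg (Polynomial.map (ι.symm : ℂ →+* PadicAlgCl p)) (cubic_adjoint_identity hx hy hQ)
  simp only [Polynomial.map_mul, Polynomial.map_sub, Polynomial.map_add, Polynomial.map_pow,
    Polynomial.map_X, Polynomial.map_C, RingHom.coe_coe] at hC
  exact hC

end AdParams

end Summit.Langlands.Langlands.Cruxes.AdjointLiftingGL3.Birth

end
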